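import Mathlib
import Summits.Ventures.PercRepro2.Harris
import Summits.Ventures.PercRepro2.BasePrime
import Summits.Ventures.PercRepro2.LocRows
import Summits.Ventures.PercRepro2.SwRow
import Summits.Ventures.PercRepro2.SwOutCube
import Summits.Ventures.PercRepro2.SwOutMixedCubeFarDefs
import Summits.Ventures.PercRepro2.SwOutBigBlockDefs
import Summits.Ventures.PercRepro2.SwOutMixedCore

/-!
# The three pieces of the corrected block (blind cell PercRepro2, night-4 g18, 2026-08-27;
proofs/NIGHT4-G18.md §2)

Vocabulary in `SwOutMixedCore`: the corrected leak set `Leak'`, the core points `Core`, the pair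
`Pair`, the property `G5`, the three cubes `core` / `esc` / `pair` and their projections
`projA` / `projB` / `projC`.

This file names the special points `D01 f = (⊥, 1, 1, 0, f)`, `D00 f = (⊥, 0, 1, 0, f)`,
`xpt f = (⊤, 1, 0, 0, f)`, `xbar f = (⊥, 0, 1, 1, f)` and `Fpt s c f = (s, c, c, c, f)`, defines the
three PIECES of the non-leaking part of a conditioning set `Q` —

* `inA Q`: the core points, and `D01 f` when `Fpt ⊥ 1 f ∉ Q`;
* `inB Q`: the escaping points other than `D00 f` and other than the `D01 f` of piece A, and `xbar f`;
* `inC`: `xpt f` and `D00 f` —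

proves that they partition the non-leaking points (`inA_or_inB_or_inC`, the exclusions), and
collects the order facts between the special points (`D01_le_Fpt`, `D00_le_D01`, `xbar_le_Fpt`, the
monotonicity in the far arms).  The images of the pieces in their cubes and their lowerness are in
`SwOutMixedCoreLower`, the counting in `SwOutMixedCoreThm`.
-/

namespace Summit.Ventures.PercRepro2

namespace BigBlock

open scoped Classical

variable {ι κ : Type*} [Fintype ι] [DecidableEq ι] [Fintype κ] [DecidableEq κ]

section Points

/-- The core point `F(s, c, f) = (s, c, c, c, f)`. -/
def Fpt (s : Config ι) (c : Bool) (f : Config κ) : Pt ι κ := (s, c, c, c, f)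

/-- The escaping point `D01(f) = (⊥, 1, 1, 0, f)`. -/
def D01 (f : Config κ) : Pt ι κ := ((fun _ => false), true, true, false, f)

/-- The escaping point `D00(f) = (⊥, 0, 1, 0, f)`. -/
def D00 (f : Config κ) : Pt ι κ := ((fun _ => false), false, true, false, f)

/-- The pair point `x(f) = (⊤, 1, 0, 0, f)`. -/
def xpt (f : Config κ) : Pt ι κ := ((fun _ => true), true, false, false, f)

/-- The pair point `x̄(f) = (⊥, 0, 1, 1, f)`. -/
def xbar (f : Config κ) : Pt ι κ := ((fun _ => false), false, true, true, f)

omit [Fintype ι] [DecidableEq ι] [Fintype κ] [DecidableEq κ] in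
/-- `false ≤ b` is no information; `b ≤ false` forces `b = false`. -/
lemma false_of_le_false {b : Bool} (h : b ≤ false) : b = false := by
  cases b
  · rfl
  · exact absurd h (by decide)

omit [Fintype ι] [DecidableEq ι] [Fintype κ] [DecidableEq κ] in
/-- A colouring below the all-blue colouring is all blue. -/
lemma eq_const_false_of_le {s : Config ι} (h : s ≤ fun _ => false) : s = fun _ => false := by
  funext j
  exact false_of_le_false (h j)

omit [Fintype ι] [DecidableEq ι] [Fintype κ] [DecidableEq κ] in
/-- The order of the raw cube, componentwise. -/
lemma le_def' {p q : Pt ι κ} :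
    p ≤ q ↔ p.1 ≤ q.1 ∧ p.2.1 ≤ q.2.1 ∧ p.2.2.1 ≤ q.2.2.1 ∧ p.2.2.2.1 ≤ q.2.2.2.1 ∧
      p.2.2.2.2 ≤ q.2.2.2.2 :=
  Iff.rfl

omit [Fintype ι] [DecidableEq ι] [Fintype κ] [DecidableEq κ] in
/-- The core points are the points `Fpt s c f`. -/
lemma core_eq_Fpt (x : Config (ι ⊕ (Unit ⊕ κ))) :
    core x = Fpt (fun j => x (Sum.inl j)) (x (Sum.inr (Sum.inl ()))) (fun k => x (Sum.inr (Sum.inr k))) :=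
  rfl

omit [Fintype ι] [DecidableEq ι] [Fintype κ] [DecidableEq κ] in
/-- `D01 f` is escaping. -/
lemma D_D01 (f : Config κ) : D (D01 f : Pt ι κ) := ⟨rfl, rfl⟩

omit [Fintype ι] [DecidableEq ι] [Fintype κ] [DecidableEq κ] in
/-- `D00 f` is escaping. -/
lemma D_D00 (f : Config κ) : D (D00 f : Pt ι κ) := ⟨rfl, rfl⟩

omit [Fintype ι] [DecidableEq ι] [Fintype κ] [DecidableEq κ] in
/-- `xpt f` is one of the pair. -/
lemma Pair_xpt (f : Config κ) : Pair (xpt f : Pt ι κ) := ⟨rfl, rfl, rfl⟩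

omit [Fintype ι] [DecidableEq ι] [Fintype κ] [DecidableEq κ] in
/-- `xbar f` is one of the pair. -/
lemma Pair_xbar (f : Config κ) : Pair (xbar f : Pt ι κ) := ⟨rfl, rfl, rfl⟩

omit [Fintype ι] [DecidableEq ι] [Fintype κ] [DecidableEq κ] in
/-- An escaping point with `e = false` and `a = true` is `D01 f`. -/
lemma eq_D01_of_D {p : Pt ι κ} (hD : D p) (he : p.2.2.2.1 = false) (ha : p.2.1 = true) :
    p = D01 p.2.2.2.2 := by
  obtain ⟨s, a, uP, e, f⟩ := p
  obtain ⟨hs, hu⟩ := hD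
  simp only at hs hu he ha
  subst he ha
  simp only [Bool.not_false] at hu
  subst hs hu
  rfl

omit [Fintype ι] [DecidableEq ι] [Fintype κ] [DecidableEq κ] in
/-- An escaping point with `e = false` and `a = false` is `D00 f`. -/
lemma eq_D00_of_D {p : Pt ι κ} (hD : D p) (he : p.2.2.2.1 = false) (ha : p.2.1 = false) :
    p = D00 p.2.2.2.2 := by
  obtain ⟨s, a, uP, e, f⟩ := p
  obtain ⟨hs, hu⟩ := hD
  simp only at hs hu he ha
  subst he ha
  simp only [Bool.not_false] at hu
  subst hs hu
  rfl

omit [Fintype ι] [DecidableEq ι] [Fintype κ] [DecidableEq κ] in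
/-- One of the pair with `e = false` is `xpt f`. -/
lemma eq_xpt_of_Pair {p : Pt ι κ} (hP : Pair p) (he : p.2.2.2.1 = false) : p = xpt p.2.2.2.2 := by
  obtain ⟨s, a, uP, e, f⟩ := p
  obtain ⟨hs, ha, hu⟩ := hP
  simp only at hs ha hu he
  subst he
  simp only [Bool.not_false] at hs ha
  subst hs ha hu
  rfl

omit [Fintype ι] [DecidableEq ι] [Fintype κ] [DecidableEq κ] in
/-- One of the pair with `e = true` is `xbar f`. -/
lemma eq_xbar_of_Pair {p : Pt ι κ} (hP : Pair p) (he : p.2.2.2.1 = true) : p = xbar p.2.2.2.2 := by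
  obtain ⟨s, a, uP, e, f⟩ := p
  obtain ⟨hs, ha, hu⟩ := hP
  simp only at hs ha hu he
  subst he
  simp only [Bool.not_true] at hs ha
  subst hs ha hu
  rfl

omit [Fintype ι] [DecidableEq ι] [Fintype κ] [DecidableEq κ] in
/-- A core point is `core` of its projection. -/
lemma eq_core_projA_of_Core {p : Pt ι κ} (hC : Core p) : p = core (projA p) := by
  obtain ⟨s, a, uP, e, f⟩ := p
  obtain ⟨h1, h2⟩ := hC
  simp only at h1 h2
  subst h1 h2
  rfl

end Points

section Pieces

variable (Q : Set (Pt ι κ))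

/-- Piece A: the core points, and `D01 f` when `Fpt ⊥ true f ∉ Q`. -/
def inA (p : Pt ι κ) : Prop :=
  Core p ∨ (D p ∧ p.2.2.2.1 = false ∧ p.2.1 = true ∧ core (projA p) ∉ Q)

/-- Piece B: the escaping points other than `D00 f` and other than the `D01 f` of piece A, and
`xbar f`. -/
def inB (p : Pt ι κ) : Prop :=
  (D p ∧ ¬ (p.2.2.2.1 = false ∧ p.2.1 = false) ∧
    ¬ (p.2.2.2.1 = false ∧ p.2.1 = true ∧ core (projA p) ∉ Q)) ∨
    (Pair p ∧ p.2.2.2.1 = true)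

/-- Piece C: `xpt f` and `D00 f`. -/
def inC (p : Pt ι κ) : Prop :=
  (Pair p ∧ p.2.2.2.1 = false) ∨ (D p ∧ p.2.2.2.1 = false ∧ p.2.1 = false)

variable {Q}

omit [Fintype ι] [DecidableEq ι] [Fintype κ] [DecidableEq κ] in
/-- Every non-leaking point is in one of the pieces. -/
lemma inA_or_inB_or_inC {p : Pt ι κ} (h : ¬ Leak' p) : inA Q p ∨ inB Q p ∨ inC p := by
  rcases (not_leak'_iff p).1 h with hC | hD | hP
  · exact Or.inl (Or.inl hC)
  · by_cases h00 : p.2.2.2.1 = false ∧ p.2.1 = false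
    · exact Or.inr (Or.inr (Or.inr ⟨hD, h00⟩))
    · by_cases h01 : p.2.2.2.1 = false ∧ p.2.1 = true ∧ core (projA p) ∉ Q
      · exact Or.inl (Or.inr ⟨hD, h01⟩)
      · exact Or.inr (Or.inl (Or.inl ⟨hD, h00, h01⟩))
  · cases he : p.2.2.2.1
    · exact Or.inr (Or.inr (Or.inl ⟨hP, he⟩))
    · exact Or.inr (Or.inl (Or.inr ⟨hP, he⟩))

omit [Fintype ι] [DecidableEq ι] [Fintype κ] [DecidableEq κ] in
/-- Piece A consists of non-leaking points. -/
lemma not_leak'_of_inA {p : Pt ι κ} (h : inA Q p) : ¬ Leak' p := by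
  rw [not_leak'_iff]
  rcases h with h | h
  · exact Or.inl h
  · exact Or.inr (Or.inl h.1)

omit [Fintype ι] [DecidableEq ι] [Fintype κ] [DecidableEq κ] in
/-- Piece B consists of non-leaking points. -/
lemma not_leak'_of_inB {p : Pt ι κ} (h : inB Q p) : ¬ Leak' p := by
  rw [not_leak'_iff]
  rcases h with h | h
  · exact Or.inr (Or.inl h.1)
  · exact Or.inr (Or.inr h.1)

omit [Fintype ι] [DecidableEq ι] [Fintype κ] [DecidableEq κ] in
/-- Piece C consists of non-leaking points. -/
lemma not_leak'_of_inC {p : Pt ι κ} (h : inC p) : ¬ Leak' p := by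
  rw [not_leak'_iff]
  rcases h with h | h
  · exact Or.inr (Or.inr h.1)
  · exact Or.inr (Or.inl h.1)

omit [Fintype ι] [DecidableEq ι] [Fintype κ] [DecidableEq κ] in
/-- Pieces A and B are disjoint. -/
lemma not_inA_and_inB {p : Pt ι κ} : ¬ (inA Q p ∧ inB Q p) := by
  rintro ⟨hA | hA, hB | hB⟩
  · exact not_Core_and_D p ⟨hA, hB.1⟩
  · exact not_Core_and_Pair p ⟨hA, hB.1⟩
  · exact hB.2.2 hA.2
  · exact not_D_and_Pair p ⟨hA.1, hB.1⟩

omit [Fintype ι] [DecidableEq ι] [Fintype κ] [DecidableEq κ] in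
/-- Pieces A and C are disjoint. -/
lemma not_inA_and_inC {p : Pt ι κ} : ¬ (inA Q p ∧ inC p) := by
  rintro ⟨hA | hA, hC | hC⟩
  · exact not_Core_and_Pair p ⟨hA, hC.1⟩
  · exact not_Core_and_D p ⟨hA, hC.1⟩
  · exact not_D_and_Pair p ⟨hA.1, hC.1⟩
  · rw [hA.2.2.1] at hC
    exact absurd hC.2.2 (by decide)

omit [Fintype ι] [DecidableEq ι] [Fintype κ] [DecidableEq κ] in
/-- Pieces B and C are disjoint. -/
lemma not_inB_and_inC {p : Pt ι κ} : ¬ (inB Q p ∧ inC p) := by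
  rintro ⟨hB | hB, hC | hC⟩
  · exact not_D_and_Pair p ⟨hB.1, hC.1⟩
  · exact hB.2.1 hC.2
  · rw [hB.2] at hC
    exact absurd hC.2 (by decide)
  · exact not_D_and_Pair p ⟨hC.1, hB.1⟩

end Pieces

section Mono

omit [Fintype ι] [DecidableEq ι] [Fintype κ] [DecidableEq κ] in
/-- `D01` is monotone in the far arms. -/
lemma D01_mono {f f' : Config κ} (h : f ≤ f') : (D01 f : Pt ι κ) ≤ D01 f' :=
  ⟨le_rfl, le_rfl, le_rfl, le_rfl, h⟩

omit [Fintype ι] [DecidableEq ι] [Fintype κ] [DecidableEq κ] in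
/-- `D00` is monotone in the far arms. -/
lemma D00_mono {f f' : Config κ} (h : f ≤ f') : (D00 f : Pt ι κ) ≤ D00 f' :=
  ⟨le_rfl, le_rfl, le_rfl, le_rfl, h⟩

omit [Fintype ι] [DecidableEq ι] [Fintype κ] [DecidableEq κ] in
/-- `xpt` is monotone in the far arms. -/
lemma xpt_mono {f f' : Config κ} (h : f ≤ f') : (xpt f : Pt ι κ) ≤ xpt f' :=
  ⟨le_rfl, le_rfl, le_rfl, le_rfl, h⟩

omit [Fintype ι] [DecidableEq ι] [Fintype κ] [DecidableEq κ] in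
/-- `xbar` is monotone in the far arms. -/
lemma xbar_mono {f f' : Config κ} (h : f ≤ f') : (xbar f : Pt ι κ) ≤ xbar f' :=
  ⟨le_rfl, le_rfl, le_rfl, le_rfl, h⟩

omit [Fintype ι] [DecidableEq ι] [Fintype κ] [DecidableEq κ] in
/-- `Fpt ⊥ true` is monotone in the far arms. -/
lemma Fpt_bot_true_mono {f f' : Config κ} (h : f ≤ f') :
    (Fpt (fun _ => false) true f : Pt ι κ) ≤ Fpt (fun _ => false) true f' :=
  ⟨le_rfl, le_rfl, le_rfl, le_rfl, h⟩

omit [Fintype ι] [DecidableEq ι] [Fintype κ] [DecidableEq κ] in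
/-- `D01 f ≤ Fpt ⊥ true f`. -/
lemma D01_le_Fpt (f : Config κ) : (D01 f : Pt ι κ) ≤ Fpt (fun _ => false) true f :=
  ⟨le_rfl, le_rfl, le_rfl, Bool.false_le _, le_rfl⟩

omit [Fintype ι] [DecidableEq ι] [Fintype κ] [DecidableEq κ] in
/-- `D00 f ≤ D01 f`. -/
lemma D00_le_D01 (f : Config κ) : (D00 f : Pt ι κ) ≤ D01 f :=
  ⟨le_rfl, Bool.false_le _, le_rfl, le_rfl, le_rfl⟩

omit [Fintype ι] [DecidableEq ι] [Fintype κ] [DecidableEq κ] in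
/-- `xbar f ≤ Fpt ⊥ true f`. -/
lemma xbar_le_Fpt (f : Config κ) : (xbar f : Pt ι κ) ≤ Fpt (fun _ => false) true f :=
  ⟨le_rfl, Bool.false_le _, le_rfl, le_rfl, le_rfl⟩

omit [Fintype ι] [DecidableEq ι] [Fintype κ] [DecidableEq κ] in
/-- `esc` is monotone at a fixed `t`. -/
lemma esc_le_esc_of_eq {y y' : Config (Fin 2 ⊕ κ)} (h : y' ≤ y) (ht : y' (Sum.inl 0) = y (Sum.inl 0)) :
    (esc y' : Pt ι κ) ≤ esc y :=
  ⟨fun _ => le_of_eq ht, h _, le_of_eq (congrArg (fun b => !b) ht), le_of_eq ht, fun _ => h _⟩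

omit [Fintype ι] [DecidableEq ι] [Fintype κ] [DecidableEq κ] in
/-- An escaping point is `esc` of its projection. -/
lemma eq_esc_projB_of_D {p : Pt ι κ} (hD : D p) : p = esc (projB p) := by
  obtain ⟨s, a, uP, e, f⟩ := p
  obtain ⟨hs, hu⟩ := hD
  simp only at hs hu
  subst hs hu
  rw [esc_projB]
  simp only [Bool.not_not]

end Mono

end BigBlock

end Summit.Ventures.PercRepro2
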